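import Summits.CriticalPhenomena.PercolationContinuityZ3.Theorems.PercNearOneGluingNoHeavyLowerTailCousinCex

/-!
# `NoHeavyLowerTail` (crux stmt-CriticalPhenomena-4575): the MASTER GLUING RULE with an arbitrary witness relay
# is FALSE — a certified weighted counterexample on seven vertices

Lemma factory #8 (`prim-lf-8`, technique tie/glue-locus exclusion), gen 3, 2026-08-19; memo
`run/shared/lean/prim/prim-lf-8/MGR-CEX.md`.  Setting as in `…MLnaCex` / `…CousinCex`: `μ_w = prodBernoulli w` on
`Fin n`, relays `A`, level `j`, `π(x) = {a ∈ A : x ↔ a}` (a relay counts itself), `N_x = |π(x)|`.  The T-FORM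
(pre-FKG cumulative isolation at a non-relay observer `y` with witness relay `c`) is

  `T_w(y, c) :  μ_w(1 ≤ N_y ≤ j) ≤ μ_w(1 ≤ N_y ∧ |π(c)| ≤ j)`.

The MASTER GLUING RULE (MGR; lead of the crux, memo `run/shared/lean/prim/prim-nh-lead-4575/LEAD-GEN3.md` §8,
0 failures in 396 k random premise-instances) asserted: for every weighted graph, level, relay `c` and set `S` of
non-relay vertices glued into one vertex `s*`, if `T(y, c)` holds for every `y ∈ S` then `T(s*, c)` holds in the
glued graph.  For `S = {u, v}` gluing is `w[s(u,v) ↦ 1]` (`Function.update w s(u, v) 1`, as in `…HubMove` /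
`…CousinCex`) and `s*` is represented by `u`.

**It is false**, already for `|S| = 2` (`not_masterGluingRule_seven`, `masterGluingRule_cex_seven`, `not_masterGluingRule`):
`n = 7`, `A = {1,2,3,4,5}`, `j = 2`, `u = 0`, `v = 6`, `c = 5`, weights `w(0,2) = w(2,6) = 1/2`,
`w(0,1) = w(1,6) = 1/10`, `w(2,5) = 9/10`, `w(1,5) = w(1,3) = 1/2`, `w(3,4) = 9/10`, all other pairs `0`:
`T(0,5)` and `T(6,5)` hold (`201/800 ≤ 81/320`, slack `3/1600` each), but after gluing `0` and `6`
`μ(1 ≤ N_0 ≤ 2) = 5631/16000 > 351/1000 = μ(1 ≤ N_0 ∧ |π(5)| ≤ 2)` (margin `−3/3200`).  Mechanism: each observer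
is valid for the non-champion relay `5` only thanks to its unattached mass (`N_y = 0` with probability `9/20`);
gluing squares that mass away while the attached penalty adds up.  The rule with `c` a CHAMPION of the unglued
graph (the lead's UNGLUE-CIL) is NOT refuted, nor is the cumulative isolation lemma (it holds at `0`, `6` and
`s*` here).  Found by a scale-free climb from the infeasible side (violations of such implications sit at the
tight-hypothesis locus, invisible to random premises), then coarsened to the weights above; two independent
exact evaluations outside Lean agree with the kernel arithmetic below.

Contents: the relay count on `Fin 7` for `A = {1,…,5}` (`nrel7`), the two events of the T-form as `Bool` tests
and exact counts (`smallB`/`cntSmall`, `attLightB`/`cntAttLight`), the witness family `cM q` (`q` = weight of the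
glued pair `0–6`, listed FIRST so that gluing is `q ↦ 1` via `CousinCex.update_wOfList_cons_one`), the arithmetic
by KERNEL reduction (`decide +kernel` over `2⁹` configurations, standard axioms, no `native_decide`), the measure
side (`real_small`, `real_attLight` via `WorstPairExchangeCex.real_eq_wcount`) and the three deliverables.
No sorries; the `def`s are computable checkers and witness data only.
-/

namespace Summit.CriticalPhenomena.PercolationContinuityZ3.Theorems

open MeasureTheory
open Literature.Probability.LatticeModels Literature.Probability.Percolation
open Summit.CriticalPhenomena.PercolationContinuityZ3.Theorems.AdditiveGluing.Negative.Cert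
open Summit.CriticalPhenomena.PercolationContinuityZ3.Theorems.WorstPairExchangeCex (real_eq_wcount)

namespace MasterGluingCex

/-! ### The T-form events as `Bool` tests and exact counts (`Fin 7`, relays `{1,2,3,4,5}`, level `2`) -/

/-- Number of relays `{1,…,5}` reachable from `x` on a reach table of `Fin 7`. -/
def nrel7 (tb : List ℕ) (x : Fin 7) : ℕ :=
  (({1, 2, 3, 4, 5} : Finset (Fin 7)).filter fun z : Fin 7 => (tb.getD x.val 0).testBit z.val = true).card

/-- `1 ≤ N_x ≤ 2` on a reach table. -/
def smallB (tb : List ℕ) (x : Fin 7) : Bool := decide (1 ≤ nrel7 tb x ∧ nrel7 tb x ≤ 2)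

/-- `1 ≤ N_x ∧ |π(c)| ≤ 2` on a reach table. -/
def attLightB (tb : List ℕ) (x c : Fin 7) : Bool := decide (1 ≤ nrel7 tb x ∧ nrel7 tb c ≤ 2)

/-- Exact count of `{1 ≤ N_x ≤ 2}` for a weighted edge list on `Fin 7`. -/
def cntSmall (l : List (Fin 7 × Fin 7 × ℚ)) (x : Fin 7) : ℚ :=
  ((wtabs 7 l).map fun t => if smallB t.1 x then t.2 else 0).sum

/-- Exact count of `{1 ≤ N_x ∧ |π(c)| ≤ 2}` for a weighted edge list on `Fin 7`. -/
def cntAttLight (l : List (Fin 7 × Fin 7 × ℚ)) (x c : Fin 7) : ℚ :=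
  ((wtabs 7 l).map fun t => if attLightB t.1 x c then t.2 else 0).sum

/-! ### The witness family (`q` = weight of the glued pair `0–6`, listed first) -/

/-- The witness: pairs `0–6 q · 0–2 1/2 · 2–6 1/2 · 0–1 1/10 · 1–6 1/10 · 2–5 9/10 · 1–5 1/2 · 1–3 1/2 · 3–4 9/10`. -/
def cM (q : ℚ) : List (Fin 7 × Fin 7 × ℚ) :=
  [(0, 6, q), (0, 2, 1/2), (2, 6, 1/2), (0, 1, 1/10), (1, 6, 1/10), (2, 5, 9/10), (1, 5, 1/2), (1, 3, 1/2),
    (3, 4, 9/10)]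

/-- The listed pairs of the witness are distinct. [this file] -/
theorem cM_nodup (q : ℚ) : (wPairs (cM q)).Nodup := by
  have h : wPairs (cM q) = wPairs (cM 0) := rfl
  rw [h]; decide

/-- The weights of the witness lie in `[0, 1]` when `q` does. [this file] -/
theorem cM_weights (q : ℚ) (hq : 0 ≤ q ∧ q ≤ 1) : ∀ e ∈ cM q, 0 ≤ e.2.2 ∧ e.2.2 ≤ 1 := by
  intro e he
  simp only [cM, List.mem_cons, List.not_mem_nil, or_false] at he
  rcases he with rfl | rfl | rfl | rfl | rfl | rfl | rfl | rfl | rfl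
  · exact hq
  all_goals norm_num

/-! ### The arithmetic (exact rational counts, kernel reduction) -/

/-- In the unglued graph (`q = 0`) both T-forms hold: `cntSmall ≤ cntAttLight` at `0` and at `6` for the
witness relay `5` (values `201/800 ≤ 81/320` each); in the glued graph (`q = 1`) the T-form at `0` FAILS
(`351/1000 < 5631/16000`). [this file] -/
theorem facts_M : cntSmall (cM 0) 0 ≤ cntAttLight (cM 0) 0 5 ∧ cntSmall (cM 0) 6 ≤ cntAttLight (cM 0) 6 5 ∧
    cntAttLight (cM 1) 0 5 < cntSmall (cM 1) 0 := by
  decide +kernel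

/-- The exact values (for the record): `201/800`, `81/320` (twice) and `5631/16000`, `351/1000`. [this file] -/
theorem values_M : cntSmall (cM 0) 0 = 201/800 ∧ cntAttLight (cM 0) 0 5 = 81/320 ∧
    cntSmall (cM 0) 6 = 201/800 ∧ cntAttLight (cM 0) 6 5 = 81/320 ∧
    cntSmall (cM 1) 0 = 5631/16000 ∧ cntAttLight (cM 1) 0 5 = 351/1000 := by
  decide +kernel

/-! ### Measure side -/

open scoped Classical

/-- Per-configuration agreement of the relay count. [this file] -/
theorem nrel7_reachTable (ω : List (Fin 7 × Fin 7)) (x : Fin 7) :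
    nrel7 (reachTable 7 ω) x =
      (({1, 2, 3, 4, 5} : Finset (Fin 7)).filter fun z => (↑(Eset ω) : Set (Sym2 (Fin 7))) ∈ openConn x z).card := by
  unfold nrel7
  rw [Finset.filter_congr fun z _ => testBit_reachTable_iff_mem_openConn ω x z]

/-- `μ(1 ≤ N_x ≤ 2) = cntSmall`. [this file] -/
theorem real_small {l : List (Fin 7 × Fin 7 × ℚ)} (hnd : (wPairs l).Nodup)
    (hq : ∀ e ∈ l, 0 ≤ e.2.2 ∧ e.2.2 ≤ 1) (x : Fin 7) :
    (prodBernoulli (wOfList l)).real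
        {ω : BondConfig (Fin 7) |
          1 ≤ (({1, 2, 3, 4, 5} : Finset (Fin 7)).filter fun z => ω ∈ openConn x z).card ∧
          (({1, 2, 3, 4, 5} : Finset (Fin 7)).filter fun z => ω ∈ openConn x z).card ≤ 2} = (cntSmall l x : ℝ) := by
  refine real_eq_wcount hnd hq (fun tb => smallB tb x) _ fun ω => ?_
  simp only [smallB, decide_eq_true_eq, Set.mem_setOf_eq, nrel7_reachTable]

/-- `μ(1 ≤ N_x ∧ |π(c)| ≤ 2) = cntAttLight`. [this file] -/
theorem real_attLight {l : List (Fin 7 × Fin 7 × ℚ)} (hnd : (wPairs l).Nodup)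
    (hq : ∀ e ∈ l, 0 ≤ e.2.2 ∧ e.2.2 ≤ 1) (x c : Fin 7) :
    (prodBernoulli (wOfList l)).real
        {ω : BondConfig (Fin 7) |
          1 ≤ (({1, 2, 3, 4, 5} : Finset (Fin 7)).filter fun z => ω ∈ openConn x z).card ∧
          (({1, 2, 3, 4, 5} : Finset (Fin 7)).filter fun z => ω ∈ openConn c z).card ≤ 2} =
      (cntAttLight l x c : ℝ) := by
  refine real_eq_wcount hnd hq (fun tb => attLightB tb x c) _ fun ω => ?_
  simp only [attLightB, decide_eq_true_eq, Set.mem_setOf_eq, nrel7_reachTable]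

end MasterGluingCex

open MasterGluingCex CousinCex
open scoped Classical

/-- **The master gluing rule fails on seven vertices.**  For `n = 7`, relays `A = {1,2,3,4,5}` and level
`j = 2` it is NOT true that for every weight `w`, all non-relay vertices `u ≠ v` with `w s(u,v) = 0` and every
relay `c`, the T-forms `T_w(u,c)` and `T_w(v,c)` imply the T-form `T_{w[s(u,v) ↦ 1]}(u, c)` of the glued vertex:
witness `cM`, `u = 0`, `v = 6`, `c = 5`. [this file] -/
theorem not_masterGluingRule_seven :
    ¬ (∀ (w : Sym2 (Fin 7) → unitInterval) (u v c : Fin 7),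
      u ∉ ({1, 2, 3, 4, 5} : Finset (Fin 7)) → v ∉ ({1, 2, 3, 4, 5} : Finset (Fin 7)) → u ≠ v →
      c ∈ ({1, 2, 3, 4, 5} : Finset (Fin 7)) → w s(u, v) = 0 →
      (prodBernoulli w).real {ω : BondConfig (Fin 7) |
          1 ≤ (({1, 2, 3, 4, 5} : Finset (Fin 7)).filter fun a => ω ∈ openConn u a).card ∧
          (({1, 2, 3, 4, 5} : Finset (Fin 7)).filter fun a => ω ∈ openConn u a).card ≤ 2} ≤
        (prodBernoulli w).real {ω : BondConfig (Fin 7) |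
          1 ≤ (({1, 2, 3, 4, 5} : Finset (Fin 7)).filter fun a => ω ∈ openConn u a).card ∧
          (({1, 2, 3, 4, 5} : Finset (Fin 7)).filter fun a => ω ∈ openConn c a).card ≤ 2} →
      (prodBernoulli w).real {ω : BondConfig (Fin 7) |
          1 ≤ (({1, 2, 3, 4, 5} : Finset (Fin 7)).filter fun a => ω ∈ openConn v a).card ∧
          (({1, 2, 3, 4, 5} : Finset (Fin 7)).filter fun a => ω ∈ openConn v a).card ≤ 2} ≤
        (prodBernoulli w).real {ω : BondConfig (Fin 7) |
          1 ≤ (({1, 2, 3, 4, 5} : Finset (Fin 7)).filter fun a => ω ∈ openConn v a).card ∧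
          (({1, 2, 3, 4, 5} : Finset (Fin 7)).filter fun a => ω ∈ openConn c a).card ≤ 2} →
      (prodBernoulli (Function.update w s(u, v) 1)).real {ω : BondConfig (Fin 7) |
          1 ≤ (({1, 2, 3, 4, 5} : Finset (Fin 7)).filter fun a => ω ∈ openConn u a).card ∧
          (({1, 2, 3, 4, 5} : Finset (Fin 7)).filter fun a => ω ∈ openConn u a).card ≤ 2} ≤
        (prodBernoulli (Function.update w s(u, v) 1)).real {ω : BondConfig (Fin 7) |
          1 ≤ (({1, 2, 3, 4, 5} : Finset (Fin 7)).filter fun a => ω ∈ openConn u a).card ∧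
          (({1, 2, 3, 4, 5} : Finset (Fin 7)).filter fun a => ω ∈ openConn c a).card ≤ 2}) := by
  intro h
  obtain ⟨hT0, hT6, hglued⟩ := facts_M
  have hq0 : (0 : ℚ) ≤ 0 ∧ (0 : ℚ) ≤ 1 := ⟨le_rfl, zero_le_one⟩
  have hq1 : (0 : ℚ) ≤ 1 ∧ (1 : ℚ) ≤ 1 := ⟨zero_le_one, le_rfl⟩
  have hw0 : wOfList (cM 0) s(0, 6) = 0 := by
    have h' : wOfList (cM 0) s((0 : Fin 7), 6) = Set.projIcc (0 : ℝ) 1 zero_le_one ((0 : ℚ) : ℝ) := by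
      simp [cM, wOfList, mkE]
    rw [h', projIcc_ratCast_zero]
  have hglu := update_wOfList_cons_one (0 : Fin 7) 6 0
    [(0, 2, 1/2), (2, 6, 1/2), (0, 1, 1/10), (1, 6, 1/10), (2, 5, 9/10), (1, 5, 1/2), (1, 3, 1/2), (3, 4, 9/10)]
  have hu : (prodBernoulli (wOfList (cM 0))).real {ω : BondConfig (Fin 7) |
        1 ≤ (({1, 2, 3, 4, 5} : Finset (Fin 7)).filter fun a => ω ∈ openConn (0 : Fin 7) a).card ∧
        (({1, 2, 3, 4, 5} : Finset (Fin 7)).filter fun a => ω ∈ openConn (0 : Fin 7) a).card ≤ 2} ≤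
      (prodBernoulli (wOfList (cM 0))).real {ω : BondConfig (Fin 7) |
        1 ≤ (({1, 2, 3, 4, 5} : Finset (Fin 7)).filter fun a => ω ∈ openConn (0 : Fin 7) a).card ∧
        (({1, 2, 3, 4, 5} : Finset (Fin 7)).filter fun a => ω ∈ openConn (5 : Fin 7) a).card ≤ 2} := by
    rw [real_small (cM_nodup 0) (cM_weights 0 hq0), real_attLight (cM_nodup 0) (cM_weights 0 hq0)]
    exact_mod_cast hT0
  have hv : (prodBernoulli (wOfList (cM 0))).real {ω : BondConfig (Fin 7) |
        1 ≤ (({1, 2, 3, 4, 5} : Finset (Fin 7)).filter fun a => ω ∈ openConn (6 : Fin 7) a).card ∧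
        (({1, 2, 3, 4, 5} : Finset (Fin 7)).filter fun a => ω ∈ openConn (6 : Fin 7) a).card ≤ 2} ≤
      (prodBernoulli (wOfList (cM 0))).real {ω : BondConfig (Fin 7) |
        1 ≤ (({1, 2, 3, 4, 5} : Finset (Fin 7)).filter fun a => ω ∈ openConn (6 : Fin 7) a).card ∧
        (({1, 2, 3, 4, 5} : Finset (Fin 7)).filter fun a => ω ∈ openConn (5 : Fin 7) a).card ≤ 2} := by
    rw [real_small (cM_nodup 0) (cM_weights 0 hq0), real_attLight (cM_nodup 0) (cM_weights 0 hq0)]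
    exact_mod_cast hT6
  have hc := h (wOfList (cM 0)) 0 6 5 (by decide) (by decide) (by decide) (by decide) hw0 hu hv
  rw [cM, hglu, ← cM, real_small (cM_nodup 1) (cM_weights 1 hq1), real_attLight (cM_nodup 1) (cM_weights 1 hq1)]
    at hc
  have hc' : cntSmall (cM 1) 0 ≤ cntAttLight (cM 1) 0 5 := by exact_mod_cast hc
  exact absurd hc' (not_le.2 hglued)

/-- **The counterexample as an instance** (same data): a weight on `Fin 7` with `w s(0,6) = 0` for which both
T-forms hold at `0` and `6` for the relay `5` while the T-form of the glued vertex fails. [this file] -/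
theorem masterGluingRule_cex_seven : ∃ (w : Sym2 (Fin 7) → unitInterval),
    w s(0, 6) = 0 ∧
    (prodBernoulli w).real {ω : BondConfig (Fin 7) |
        1 ≤ (({1, 2, 3, 4, 5} : Finset (Fin 7)).filter fun a => ω ∈ openConn (0 : Fin 7) a).card ∧
        (({1, 2, 3, 4, 5} : Finset (Fin 7)).filter fun a => ω ∈ openConn (0 : Fin 7) a).card ≤ 2} ≤
      (prodBernoulli w).real {ω : BondConfig (Fin 7) |
        1 ≤ (({1, 2, 3, 4, 5} : Finset (Fin 7)).filter fun a => ω ∈ openConn (0 : Fin 7) a).card ∧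
        (({1, 2, 3, 4, 5} : Finset (Fin 7)).filter fun a => ω ∈ openConn (5 : Fin 7) a).card ≤ 2} ∧
    (prodBernoulli w).real {ω : BondConfig (Fin 7) |
        1 ≤ (({1, 2, 3, 4, 5} : Finset (Fin 7)).filter fun a => ω ∈ openConn (6 : Fin 7) a).card ∧
        (({1, 2, 3, 4, 5} : Finset (Fin 7)).filter fun a => ω ∈ openConn (6 : Fin 7) a).card ≤ 2} ≤
      (prodBernoulli w).real {ω : BondConfig (Fin 7) |
        1 ≤ (({1, 2, 3, 4, 5} : Finset (Fin 7)).filter fun a => ω ∈ openConn (6 : Fin 7) a).card ∧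
        (({1, 2, 3, 4, 5} : Finset (Fin 7)).filter fun a => ω ∈ openConn (5 : Fin 7) a).card ≤ 2} ∧
    (prodBernoulli (Function.update w s(0, 6) 1)).real {ω : BondConfig (Fin 7) |
        1 ≤ (({1, 2, 3, 4, 5} : Finset (Fin 7)).filter fun a => ω ∈ openConn (0 : Fin 7) a).card ∧
        (({1, 2, 3, 4, 5} : Finset (Fin 7)).filter fun a => ω ∈ openConn (5 : Fin 7) a).card ≤ 2} <
      (prodBernoulli (Function.update w s(0, 6) 1)).real {ω : BondConfig (Fin 7) |
        1 ≤ (({1, 2, 3, 4, 5} : Finset (Fin 7)).filter fun a => ω ∈ openConn (0 : Fin 7) a).card ∧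
        (({1, 2, 3, 4, 5} : Finset (Fin 7)).filter fun a => ω ∈ openConn (0 : Fin 7) a).card ≤ 2} := by
  obtain ⟨hT0, hT6, hglued⟩ := facts_M
  have hq0 : (0 : ℚ) ≤ 0 ∧ (0 : ℚ) ≤ 1 := ⟨le_rfl, zero_le_one⟩
  have hq1 : (0 : ℚ) ≤ 1 ∧ (1 : ℚ) ≤ 1 := ⟨zero_le_one, le_rfl⟩
  have hw0 : wOfList (cM 0) s(0, 6) = 0 := by
    have h' : wOfList (cM 0) s((0 : Fin 7), 6) = Set.projIcc (0 : ℝ) 1 zero_le_one ((0 : ℚ) : ℝ) := by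
      simp [cM, wOfList, mkE]
    rw [h', projIcc_ratCast_zero]
  have hglu := update_wOfList_cons_one (0 : Fin 7) 6 0
    [(0, 2, 1/2), (2, 6, 1/2), (0, 1, 1/10), (1, 6, 1/10), (2, 5, 9/10), (1, 5, 1/2), (1, 3, 1/2), (3, 4, 9/10)]
  refine ⟨wOfList (cM 0), hw0, ?_, ?_, ?_⟩
  · rw [real_small (cM_nodup 0) (cM_weights 0 hq0), real_attLight (cM_nodup 0) (cM_weights 0 hq0)]
    exact_mod_cast hT0
  · rw [real_small (cM_nodup 0) (cM_weights 0 hq0), real_attLight (cM_nodup 0) (cM_weights 0 hq0)]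
    exact_mod_cast hT6
  · rw [cM, hglu, ← cM, real_small (cM_nodup 1) (cM_weights 1 hq1), real_attLight (cM_nodup 1) (cM_weights 1 hq1)]
    exact_mod_cast hglued

/-- **The master gluing rule (arbitrary witness relay) is FALSE.**  It is NOT true that for all `n`, relays
`A`, levels `j ≥ 1` with `j + 3 ≤ |A|`, weights `w`, non-relay vertices `u ≠ v` with `w s(u,v) = 0` and relays
`c ∈ A`, the T-forms at `u` and at `v` for `c` imply the T-form for `c` at the glued vertex under `w[s(u,v) ↦ 1]`
(`not_masterGluingRule_seven`: `n = 7`, `A = {1,…,5}`, `j = 2`).  The champion version (UNGLUE-CIL) and the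
cumulative isolation lemma are not refuted. [this file] -/
theorem not_masterGluingRule :
    ¬ (∀ (n : ℕ) (A : Finset (Fin n)) (j : ℕ) (w : Sym2 (Fin n) → unitInterval) (u v c : Fin n),
      1 ≤ j → j + 3 ≤ A.card → u ∉ A → v ∉ A → u ≠ v → c ∈ A → w s(u, v) = 0 →
      (prodBernoulli w).real {ω : BondConfig (Fin n) |
          1 ≤ (A.filter fun a => ω ∈ openConn u a).card ∧ (A.filter fun a => ω ∈ openConn u a).card ≤ j} ≤
        (prodBernoulli w).real {ω : BondConfig (Fin n) |
          1 ≤ (A.filter fun a => ω ∈ openConn u a).card ∧ (A.filter fun a => ω ∈ openConn c a).card ≤ j} →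
      (prodBernoulli w).real {ω : BondConfig (Fin n) |
          1 ≤ (A.filter fun a => ω ∈ openConn v a).card ∧ (A.filter fun a => ω ∈ openConn v a).card ≤ j} ≤
        (prodBernoulli w).real {ω : BondConfig (Fin n) |
          1 ≤ (A.filter fun a => ω ∈ openConn v a).card ∧ (A.filter fun a => ω ∈ openConn c a).card ≤ j} →
      (prodBernoulli (Function.update w s(u, v) 1)).real {ω : BondConfig (Fin n) |
          1 ≤ (A.filter fun a => ω ∈ openConn u a).card ∧ (A.filter fun a => ω ∈ openConn u a).card ≤ j} ≤
        (prodBernoulli (Function.update w s(u, v) 1)).real {ω : BondConfig (Fin n) |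
          1 ≤ (A.filter fun a => ω ∈ openConn u a).card ∧ (A.filter fun a => ω ∈ openConn c a).card ≤ j}) := by
  intro h
  exact not_masterGluingRule_seven fun w u v c => h 7 {1, 2, 3, 4, 5} 2 w u v c (by norm_num) (by decide)

end Summit.CriticalPhenomena.PercolationContinuityZ3.Theorems
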